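import Summits.CriticalPhenomena.SAWScalingLimit.Theorems.SAWLeftRightFKGFKGToTraversalBoundTameRect
import HarnessLib

/-!
# Discs are tame at every mesh (stubs `tamePresentation_ball`, `eventuallyTame_unitDisc`)

Crux `SAWLeftRightFKG.FKGToTraversalBound` (stmt-CriticalPhenomena-1878), line `slit-necklace`, registered stubs
`tamePresentation_ball` and `eventuallyTame_unitDisc`: the open unit disc — the carrier of
`DobrushinDomain.unitDisc`, THE domain of the crux's deep-fragment certificates (`Negative/R1Split`,
`DeepStartNotPresentable`) — is
`EventuallyTame` (`Theorems/SAWLeftRightFKGFKGToTraversalBoundSlitNecklaceDefs.lean`), with defect budget `N₀ = 0`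
and in fact at EVERY mesh `δ > 0` and for every radius (`tamePresentation_ball_of_pos`), so that the landed tame
necklace reduction of the line applies to it.

**Proof.**  Fix `δ > 0`, a radius `ρ`, and let `V = {x | ‖δ x‖ < ρ}` be the mesh vertices of `Ω = ball 0 ρ`
(`mem_meshVertices_ball_iff`).  Lattice neighbours in `V` are mesh neighbours (the segment lies in the convex ball,
`meshGraph_adj_ball`).  The digital disc is connected through the axes: one lattice step towards the centre
site `0` (`exists_step_towards`) does not increase either `|x 0|` or `|x 1|`, hence not the norm
(`norm_meshPoint_le_of_sq_le`), so it stays in `V`; by induction on `|x 0| + |x 1|` every vertex reaches `0`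
(`reachable_zero_ball`), the mesh vertex graph is preconnected and the discrete domain is all of `V`
(`meshDomain_ball`, `Literature.Probability.Percolation.meshDomain_eq_meshVertices_of_preconnected`).  `V` lies
strictly inside the box `(-M, M)²`, `M = ⌈ρ/δ⌉` (`|δ x i| ≤ ‖δ x‖ < ρ`, `box_of_mem_ball`).  Hole-freeness: a
site `k` of the closed box off `V` (`ρ ≤ ‖δ k‖`) escapes to the wall `{x 0 = ±M}` along the straight horizontal
ray AWAY from the vertical axis (`exists_ray_walk_right/left`): along it `|z 0|` increases and `z 1 = k 1`, so
the norm does not decrease and the ray stays off `V` and in the closed box (`holeFree_ball`).  Hence the landed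
tool `tamePresentation_of_holeFree`
(`Theorems/SAWLeftRightFKGFKGToTraversalBoundTamePresentation.lean`, p163151) applies:
`TamePresentation (ball 0 ρ) δ 0` for every `δ > 0`; `ρ = 1` is `tamePresentation_ball`, and
`eventuallyTame_unitDisc` follows with `N₀ = 0` (`DobrushinDomain.unitDisc.carrier = ball 0 1` by `rfl`).
No named fact; axioms are the standard three.
-/

noncomputable section

open Set Filter Topology Metric
open Literature.Probability.LatticeModels Literature.Probability.RandomPlanarGeometry

namespace Summit.CriticalPhenomena.SAWScalingLimit.Theorems.FKGToTraversalBound.SlitNecklace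

/-! ### Straight horizontal lattice walks -/

/-- The straight lattice walk of `n` unit steps from `k` in the direction `+e₀`: it ends on the vertical line
`x 0 = k 0 + n` and its sites `z` have `z 1 = k 1` and `k 0 ≤ z 0 ≤ k 0 + n`. [folklore] -/
theorem exists_ray_walk_right : ∀ (n : ℕ) (k : Site 2),
    ∃ (q : Site 2) (p : (zdGraph 2).Walk k q), q 0 = k 0 + n ∧
      ∀ z ∈ p.support, z 1 = k 1 ∧ k 0 ≤ z 0 ∧ z 0 ≤ k 0 + n := by
  intro n
  induction n with
  | zero =>
    intro k
    refine ⟨k, SimpleGraph.Walk.nil, by simp, fun z hz => ?_⟩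
    rw [SimpleGraph.Walk.support_nil, List.mem_singleton] at hz
    subst hz
    simp
  | succ n ih =>
    intro k
    obtain ⟨q, p, hq, hp⟩ := ih (k + Pi.single 0 1)
    refine ⟨q, SimpleGraph.Walk.cons ((zdGraph_adj_iff _ _).2 ⟨0, Or.inl rfl⟩) p, ?_, fun z hz => ?_⟩
    · rw [hq]
      simp only [Pi.add_apply, Pi.single_eq_same]
      push_cast
      ring
    · rw [SimpleGraph.Walk.support_cons, List.mem_cons] at hz
      rcases hz with rfl | hz
      · exact ⟨rfl, le_rfl, by push_cast; omega⟩
      · obtain ⟨h1, h2, h3⟩ := hp z hz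
        simp only [Pi.add_apply, Pi.single_eq_same, Pi.single_eq_of_ne (one_ne_zero), add_zero] at h1 h2 h3
        refine ⟨h1, ?_, ?_⟩ <;> push_cast <;> omega

/-- The straight lattice walk of `n` unit steps from `k` in the direction `-e₀`: it ends on the vertical line
`x 0 = k 0 - n` and its sites `z` have `z 1 = k 1` and `k 0 - n ≤ z 0 ≤ k 0`. [folklore] -/
theorem exists_ray_walk_left : ∀ (n : ℕ) (k : Site 2),
    ∃ (q : Site 2) (p : (zdGraph 2).Walk k q), q 0 = k 0 - n ∧
      ∀ z ∈ p.support, z 1 = k 1 ∧ k 0 - n ≤ z 0 ∧ z 0 ≤ k 0 := by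
  intro n
  induction n with
  | zero =>
    intro k
    refine ⟨k, SimpleGraph.Walk.nil, by simp, fun z hz => ?_⟩
    rw [SimpleGraph.Walk.support_nil, List.mem_singleton] at hz
    subst hz
    simp
  | succ n ih =>
    intro k
    obtain ⟨q, p, hq, hp⟩ := ih (k - Pi.single 0 1)
    refine ⟨q, SimpleGraph.Walk.cons ((zdGraph_adj_iff _ _).2 ⟨0, Or.inr (by simp)⟩) p, ?_, fun z hz => ?_⟩
    · rw [hq]
      simp only [Pi.sub_apply, Pi.single_eq_same]
      push_cast
      ring
    · rw [SimpleGraph.Walk.support_cons, List.mem_cons] at hz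
      rcases hz with rfl | hz
      · exact ⟨rfl, by push_cast; omega, le_rfl⟩
      · obtain ⟨h1, h2, h3⟩ := hp z hz
        simp only [Pi.sub_apply, Pi.single_eq_same, Pi.single_eq_of_ne (one_ne_zero), sub_zero] at h1 h2 h3
        refine ⟨h1, ?_, ?_⟩ <;> push_cast <;> omega

/-! ### Mesh points of a disc: norms, adjacency, connectivity through the axes -/

/-- The squared norm of a mesh point: `‖δ x‖² = δ² (x 0² + x 1²)`. [folklore] -/
theorem sq_norm_meshPoint (δ : ℝ) (x : Site 2) :
    ‖meshPoint δ x‖ ^ 2 = δ ^ 2 * ((x 0 : ℝ) ^ 2 + (x 1 : ℝ) ^ 2) := by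
  rw [Complex.sq_norm, Complex.normSq_apply, meshPoint_re, meshPoint_im]
  ring

/-- Monotonicity of the norm of a mesh point in the integer sum of squares of the coordinates. [folklore] -/
theorem norm_meshPoint_le_of_sq_le {δ : ℝ} {x y : Site 2}
    (h : y 0 ^ 2 + y 1 ^ 2 ≤ x 0 ^ 2 + x 1 ^ 2) : ‖meshPoint δ y‖ ≤ ‖meshPoint δ x‖ := by
  have h' : (y 0 : ℝ) ^ 2 + (y 1 : ℝ) ^ 2 ≤ (x 0 : ℝ) ^ 2 + (x 1 : ℝ) ^ 2 := by exact_mod_cast h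
  rw [← sq_le_sq₀ (norm_nonneg _) (norm_nonneg _), sq_norm_meshPoint, sq_norm_meshPoint]
  exact mul_le_mul_of_nonneg_left h' (sq_nonneg δ)

/-- The mesh vertices of the disc `ball 0 ρ` at mesh `δ` are the sites `x` with `‖δ x‖ < ρ`. [folklore] -/
theorem mem_meshVertices_ball_iff {ρ δ : ℝ} {x : Site 2} :
    x ∈ meshVertices (ball (0 : ℂ) ρ) δ ↔ ‖meshPoint δ x‖ < ρ := by
  rw [mem_meshVertices_iff, Metric.mem_ball, dist_zero_right]

/-- Lattice neighbours among the mesh vertices of a disc are mesh neighbours: the segment joining the two mesh points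
lies in the convex disc, hence in its closure. [folklore] -/
theorem meshGraph_adj_ball {ρ δ : ℝ} {x y : Site 2} (hx : x ∈ meshVertices (ball (0 : ℂ) ρ) δ)
    (hy : y ∈ meshVertices (ball (0 : ℂ) ρ) δ) (h : (zdGraph 2).Adj x y) :
    (meshGraph (ball (0 : ℂ) ρ) δ).Adj x y :=
  meshGraph_adj_iff.2 ⟨h, ((convex_ball (0 : ℂ) ρ).segment_subset hx hy).trans subset_closure⟩

/-- **The digital disc is connected through the axes.**  Every mesh vertex `x` of `ball 0 ρ` is joined to the centre
site `0` inside the mesh vertex graph: by induction on `|x 0| + |x 1|`, one lattice step towards `0`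
(`exists_step_towards`) keeps both `|x 0|` and `|x 1|` from increasing, hence stays in the disc, and lattice
neighbours in the disc are mesh neighbours (`meshGraph_adj_ball`). [folklore] -/
theorem reachable_zero_ball {ρ δ : ℝ} (h0 : (0 : Site 2) ∈ meshVertices (ball (0 : ℂ) ρ) δ) :
    ∀ (n : ℕ) (x : Site 2) (hx : x ∈ meshVertices (ball (0 : ℂ) ρ) δ),
      (x 0).natAbs + (x 1).natAbs = n →
        (meshVertexGraph (ball (0 : ℂ) ρ) δ).Reachable ⟨x, hx⟩ ⟨0, h0⟩ := by
  intro n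
  induction n using Nat.strong_induction_on with
  | _ n ih =>
    intro x hx hn
    by_cases hx0 : x = 0
    · subst hx0; rfl
    obtain ⟨y, hadj, hy0, hy1, hlt⟩ := exists_step_towards x 0 hx0
    simp only [Pi.zero_apply, sub_zero] at hy0 hy1 hlt
    have hy : y ∈ meshVertices (ball (0 : ℂ) ρ) δ := by
      rw [mem_meshVertices_ball_iff]
      refine lt_of_le_of_lt (norm_meshPoint_le_of_sq_le ?_) (mem_meshVertices_ball_iff.1 hx)
      rcases hy0 with ⟨h1, h2⟩ | ⟨h1, h2⟩ <;> rcases hy1 with ⟨h3, h4⟩ | ⟨h3, h4⟩ <;> nlinarith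
    have h1 : (meshVertexGraph (ball (0 : ℂ) ρ) δ).Adj ⟨x, hx⟩ ⟨y, hy⟩ := by
      simp only [SimpleGraph.comap_adj, Function.Embedding.subtype_apply]
      exact meshGraph_adj_ball hx hy hadj
    exact h1.reachable.trans (ih _ (hn ▸ hlt) y hy rfl)

/-- The mesh vertex graph of a disc centred at `0` is preconnected (every vertex reaches the centre site,
`reachable_zero_ball`; the centre is a mesh vertex as soon as there is any). [folklore] -/
theorem preconnected_ball (ρ δ : ℝ) : (meshVertexGraph (ball (0 : ℂ) ρ) δ).Preconnected := by
  intro u w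
  have h0 : (0 : Site 2) ∈ meshVertices (ball (0 : ℂ) ρ) δ := by
    rw [mem_meshVertices_ball_iff]
    refine lt_of_le_of_lt (norm_meshPoint_le_of_sq_le ?_) (mem_meshVertices_ball_iff.1 u.2)
    simp only [Pi.zero_apply]
    positivity
  exact (reachable_zero_ball h0 _ u.1 u.2 rfl).trans (reachable_zero_ball h0 _ w.1 w.2 rfl).symm

/-- **The discrete domain of a disc centred at `0` is the whole set of its mesh vertices**, at every mesh: the mesh
vertex graph is preconnected (`preconnected_ball`), so there is a single component
(`meshDomain_eq_meshVertices_of_preconnected`). [folklore] -/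
theorem meshDomain_ball (ρ δ : ℝ) : meshDomain (ball (0 : ℂ) ρ) δ = meshVertices (ball (0 : ℂ) ρ) δ :=
  Literature.Probability.Percolation.meshDomain_eq_meshVertices_of_preconnected (preconnected_ball ρ δ)

/-! ### The box and hole-freeness -/

/-- The mesh vertices of `ball 0 ρ` at mesh `δ > 0` lie strictly inside the box `(-M, M)²`, `M = ⌈ρ/δ⌉`:
`δ |x i| ≤ ‖δ x‖ < ρ`. [folklore] -/
theorem box_of_mem_ball {ρ δ : ℝ} (hδ : 0 < δ) {x : Site 2} (hx : x ∈ meshVertices (ball (0 : ℂ) ρ) δ) :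
    -⌈ρ / δ⌉ < x 0 ∧ x 0 < ⌈ρ / δ⌉ ∧ -⌈ρ / δ⌉ < x 1 ∧ x 1 < ⌈ρ / δ⌉ := by
  have h := mem_meshVertices_ball_iff.1 hx
  have h0 := (Complex.abs_re_le_norm _).trans_lt h
  have h1 := (Complex.abs_im_le_norm _).trans_lt h
  rw [meshPoint_re, abs_mul, abs_of_pos hδ, ← lt_div_iff₀' hδ, abs_lt] at h0
  rw [meshPoint_im, abs_mul, abs_of_pos hδ, ← lt_div_iff₀' hδ, abs_lt] at h1
  have h0' := Int.lt_ceil.2 (show ((-x 0 : ℤ) : ℝ) < ρ / δ by push_cast; linarith [h0.1])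
  have h1' := Int.lt_ceil.2 (show ((-x 1 : ℤ) : ℝ) < ρ / δ by push_cast; linarith [h1.1])
  refine ⟨by omega, Int.lt_ceil.2 h0.2, by omega, Int.lt_ceil.2 h1.2⟩

/-- **The digital disc is hole-free.**  A site `k` of the closed box `[-M, M]²` off the mesh vertices of
`ball 0 ρ` (`ρ ≤ ‖δ k‖`) escapes to the wall `{x 0 = ±M}` along the horizontal ray away from the vertical axis:
along it `z 1 = k 1` and `|z 0| ≥ |k 0|`, so the norm does not decrease (`norm_meshPoint_le_of_sq_le`) and the
ray stays off the mesh vertices and inside the closed box. [folklore] -/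
theorem holeFree_ball {ρ δ : ℝ} (M : ℤ) (k : Site 2) (h1 : -M ≤ k 0) (h2 : k 0 ≤ M) (h3 : -M ≤ k 1)
    (h4 : k 1 ≤ M) (hk : k ∉ meshVertices (ball (0 : ℂ) ρ) δ) :
    ∃ (q : Site 2) (p : (zdGraph 2).Walk k q), (q 0 = -M ∨ q 0 = M ∨ q 1 = -M ∨ q 1 = M) ∧
      ∀ z ∈ p.support,
        z ∉ meshVertices (ball (0 : ℂ) ρ) δ ∧ -M ≤ z 0 ∧ z 0 ≤ M ∧ -M ≤ z 1 ∧ z 1 ≤ M := by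
  rw [mem_meshVertices_ball_iff, not_lt] at hk
  rcases le_or_gt 0 (k 0) with hk0 | hk0
  · obtain ⟨q, p, hq, hp⟩ := exists_ray_walk_right (M - k 0).toNat k
    refine ⟨q, p, Or.inr (Or.inl (by rw [hq]; omega)), fun z hz => ?_⟩
    obtain ⟨hz1, hz2, hz3⟩ := hp z hz
    refine ⟨fun hzV => ?_, by omega, by omega, by omega, by omega⟩
    have hkz : ‖meshPoint δ k‖ ≤ ‖meshPoint δ z‖ := norm_meshPoint_le_of_sq_le (by rw [hz1]; nlinarith)
    exact absurd (hk.trans hkz) (not_le.2 (mem_meshVertices_ball_iff.1 hzV))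
  · obtain ⟨q, p, hq, hp⟩ := exists_ray_walk_left (M + k 0).toNat k
    refine ⟨q, p, Or.inl (by rw [hq]; omega), fun z hz => ?_⟩
    obtain ⟨hz1, hz2, hz3⟩ := hp z hz
    refine ⟨fun hzV => ?_, by omega, by omega, by omega, by omega⟩
    have hkz : ‖meshPoint δ k‖ ≤ ‖meshPoint δ z‖ := norm_meshPoint_le_of_sq_le (by rw [hz1]; nlinarith)
    exact absurd (hk.trans hkz) (not_le.2 (mem_meshVertices_ball_iff.1 hzV))

/-! ### Discs are tame at every mesh -/

/-- **Discs centred at `0` are tame with no defect at every mesh `δ > 0`** (any radius `ρ`; for `ρ ≤ δ` the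
discrete domain is `{0}` or empty and the statement is degenerate but true): with the walls `±⌈ρ/δ⌉` the
discrete domain is the set of mesh vertices (`meshDomain_ball`), strictly inside the box (`box_of_mem_ball`),
induced (`meshGraph_adj_ball`) and hole-free (`holeFree_ball`), so `tamePresentation_of_holeFree` applies.
[folklore] -/
theorem tamePresentation_ball_of_pos : ∀ (ρ δ : ℝ), 0 < δ → TamePresentation (ball (0 : ℂ) ρ) δ 0 := by
  intro ρ δ hδ
  have hD := meshDomain_ball ρ δ
  refine tamePresentation_of_holeFree (ball (0 : ℂ) ρ) δ (-⌈ρ / δ⌉) ⌈ρ / δ⌉ (-⌈ρ / δ⌉) ⌈ρ / δ⌉ hδ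
    (fun x hx => box_of_mem_ball hδ (meshDomain_subset_meshVertices _ _ hx))
    (fun x hx y hy h => meshGraph_adj_ball (meshDomain_subset_meshVertices _ _ hx)
      (meshDomain_subset_meshVertices _ _ hy) h)
    (fun k h1 h2 h3 h4 hk => ?_)
  rw [hD] at hk ⊢
  exact holeFree_ball ⌈ρ / δ⌉ k h1 h2 h3 h4 hk

/-! ### The registered stubs -/

/-- **Registered stub `tamePresentation_ball`** (line `slit-necklace`, crux stmt-CriticalPhenomena-1878).  The open
unit disc is tame with no defect at every mesh `0 < δ < 1` (indeed at every `δ > 0`, `tamePresentation_ball_of_pos`;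
the upper bound on the mesh is not used): its discretisation `Ω_δ` IS the graph of an r2 carrier. [folklore] -/
theorem tamePresentation_ball : ∀ δ : ℝ, 0 < δ → δ < 1 → TamePresentation (Metric.ball (0 : ℂ) 1) δ 0 :=
  fun δ hδ _ => tamePresentation_ball_of_pos 1 δ hδ

/-- **Registered stub `eventuallyTame_unitDisc`** (line `slit-necklace`, crux stmt-CriticalPhenomena-1878).  The unit
disc Dobrushin domain (carrier `ball 0 1`, by `rfl`) is eventually tame, with defect budget `N₀ = 0`: at every mesh
`δ > 0` its discretisation is the graph of an r2 carrier with no defect (`tamePresentation_ball_of_pos`), in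
particular eventually as `δ → 0⁺`. [folklore] -/
theorem eventuallyTame_unitDisc : EventuallyTame DobrushinDomain.unitDisc :=
  ⟨0, eventually_nhdsWithin_of_forall fun δ hδ => tamePresentation_ball_of_pos 1 δ hδ⟩

end Summit.CriticalPhenomena.SAWScalingLimit.Theorems.FKGToTraversalBound.SlitNecklace

end
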